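import Summits.HubbardSuperconductivity.HubbardSuperconductivity.Theorems.AnisotropyChordCondensateSlabDefs
import Summits.HubbardSuperconductivity.HubbardSuperconductivity.Theorems.AnisotropyChordCondensateSlabGroundStateLimit

/-!
# Route `AnisotropyChord`, crux `ChordXY` (stmt-HubbardSuperconductivity-8146), line `condensate-slab`:
# registered stub `stub_slabGroundStateLimit` BY NAME

The lead skeleton of crux `ChordXY` (`Cruxes/ChordXY/Lines/doob_johnson_chord.lean`, merged sections
`DoobJohnsonChord` [main line] and `CondensateSlab` [second line]) registers, for the line
`condensate-slab`, the stub `stub_slabGroundStateLimit`: the ground-state limit of the SLAB condensate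
`Λˢ_{β,M}(Δ) = Re(⟨v_β, S⁺_tot S⁻_tot v_β⟩/⟨v_β, v_β⟩)`, `v_β = e^{-βH_M(Δ)} P₀𝟙`
(`slabCondensate`, landed in `…CondensateSlabDefs`).  With `slabCondensate`/`slabVec` unfolded it is the
landed `tendsto_slabCondensate_groundState` (`…CondensateSlabGroundStateLimit`: sectorwise power method
+ Perron–Frobenius uniqueness of the sector ground state + scale invariance of the Rayleigh quotient).
Bratteli–Robinson II §5.3.1; Tasaki (2020) §2.2, §4.1.  No definition is introduced; sorry-free.
HONEST: the two research stubs of the line (`stub_slabConcave_smallBeta` is a rung,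
`stub_slabConcavity_propagates` is the open XL step) are not touched; nothing here proves `ChordXY`;
superconductivity in the Hubbard model is not advanced.
-/

set_option linter.dupNamespace false

noncomputable section

namespace Summit.HubbardSuperconductivity.HubbardSuperconductivity.Theorems.AnisotropyChord.CondensateSlab

open Matrix Filter Topology
open Literature.MathematicalPhysics.QuantumLattice Literature.Probability.LatticeModels
open Summit.HubbardSuperconductivity.HubbardSuperconductivity.Theorems.AnisotropyChord

/-- **Registered stub `stub_slabGroundStateLimit`** (line `condensate-slab` of crux `ChordXY`), BY NAME —
GROUND-STATE LIMIT OF THE SLAB: for even `M ≥ 2`, every real `Δ` and every normalised `S^z_tot = 0`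
ground state `ψ` of `H_M(Δ)`, `Λˢ_{β,M}(Δ) → Re⟨ψ, S⁺_tot S⁻_tot ψ⟩` as `β → ∞`.  With the abbreviations
unfolded this is `tendsto_slabCondensate_groundState` (the hypothesis `Even M` is not needed).
Bratteli–Robinson II §5.3.1; Tasaki (2020) §2.2, §4.1. [folklore] -/
theorem stub_slabGroundStateLimit : ∀ (M : ℕ) [NeZero M], Even M → 2 ≤ M → ∀ (Δ : ℝ) (ψ : TensorIndex (TorusSite 2 M) 2 → ℂ), ψ ∈ spinZSector (Λ := TorusSite 2 M) 1 0 → star ψ ⬝ᵥ ψ = 1 → Matrix.mulVec (xxzHamiltonian 1 (torusGraph 2 M) (-1) Δ) ψ = ((lowestEnergyInSector 1 (xxzHamiltonian 1 (torusGraph 2 M) (-1) Δ) 0 : ℝ) : ℂ) • ψ → Tendsto (fun β : ℝ => slabCondensate M β Δ) atTop (𝓝 ((star ψ ⬝ᵥ Matrix.mulVec ((∑ x : TorusSite 2 M, onSite x (spinRaise 1)) * (∑ y : TorusSite 2 M, onSite y (spinLower 1))) ψ).re)) := by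
  intro M _ _ h2 Δ ψ hmem hψ1 heig
  unfold slabCondensate slabVec
  exact tendsto_slabCondensate_groundState M h2 Δ ψ hmem hψ1 heig

end Summit.HubbardSuperconductivity.HubbardSuperconductivity.Theorems.AnisotropyChord.CondensateSlab

end
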